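import Literature.NumberTheory.GaloisRepresentations.PowerSeriesTopNilpotentBasis
import HarnessLib

/-!
# `S⟦Y⟧` is FREE of rank `d` over `S⟦T⟧` (action `c(T)·r = Σ c_k D^k r`) when `D(Y^k) ≡ Y^{k+d} (mod p, Y^{k+d+1})`:
# existence by `p`-adic refinement, uniqueness, and the rank-two case (basis `{1, Y}`)
# (de Shalit I §3.1 "`Λ(𝒢) ≅ ℤ_p[Δ]⟦S⟧`", §3.7; Washington §13.2)

Sequel to `PowerSeriesTopNilpotentBasis` (the triangular system `triBasis`, the candidate basis map
`basisMap c = Σ_{j<d} c_j(T)·Y^j` and its surjectivity MODULO `p`, `exists_basisMap_add_C_mul`).  Here: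

* `remSeq`, `partSeq`, `eq_basisMap_partSeq_add` — the `p`-adic refinement `V = basisMap C_n + p^n V_n`;
* ★★ `exists_basisMap_eq` — **every `V ∈ S⟦Y⟧` is `Σ_{j<d} c_j·Y^j`** (`S` `(p)`-adically complete);
* ★★ `coeff_mem_of_basisMap_eq_zero` (leading coefficients modulo `p`), `coeff_mem_pow_of_basisMap_eq_zero` (division by `p`),
  `eq_zero_of_basisMap_eq_zero`, `eq_of_basisMap_eq` — **uniqueness** (`p` a non-zero-divisor, `⋂ (p^N) = 0`);
* ★★★ `existsUnique_basisMap` — **`S⟦Y⟧` is free of rank `d` over `S⟦T⟧` with basis `1, Y, …, Y^{d−1}`**, and the rank-two case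
  `existsUnique_tAct_one_add_tAct_X` (`d = 2`: every `V` is uniquely `a(T)·1 + b(T)·Y`) — the shape of the Coleman coordinate
  module at `q = 2` under `T = σ_γ − 1`, `γ` a topological generator of `1 + 4ℤ₂` (`𝒪⟦Y⟧ ≅ Λ(ℤ₂^×) = 𝒪[Δ]⟦T⟧`, `|Δ| = 2`; sequel).

Everything PROVED (0 sorry, no named facts); transparent definitions `remSeq`, `partSeq`.

## References

* E. de Shalit, *Iwasawa theory of elliptic curves with complex multiplication* (1987), Ch. I §3.1, §3.7. [deShalit1987]
* L. C. Washington, *Introduction to Cyclotomic Fields*, 2nd ed. (1997), §7.1, §13.2. [Washington1997]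
-/

noncomputable section

namespace Literature.NumberTheory.GaloisRepresentations

namespace LubinTate

section TopNilpotentBasisFree

open Finset

variable {S : Type*} [CommRing S] {p : S}

/-! ### The refinement sequences -/

/-- The successive remainders of a refinement step `step : V ↦ (c, W)`: `V_0 = V`, `V_{n+1} = (step V_n).2`. [cite: deShalit1987, Ch. I §3.1] -/
def remSeq (step : PowerSeries S → (ℕ → PowerSeries S) × PowerSeries S) (V : PowerSeries S) (n : ℕ) : PowerSeries S :=
  Nat.rec (motive := fun _ => PowerSeries S) V (fun _ R => (step R).2) n

omit [CommRing S] in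
/-- `V_{n+1} = (step V_n).2` (unfolding). [cite: deShalit1987, Ch. I §3.1] -/
theorem remSeq_succ (step : PowerSeries S → (ℕ → PowerSeries S) × PowerSeries S) (V : PowerSeries S) (n : ℕ) :
    remSeq step V (n + 1) = (step (remSeq step V n)).2 := rfl

variable (p) in
/-- The partial sums `C_n = Σ_{i<n} p^i · (step V_i).1` of the coefficient series. [cite: deShalit1987, Ch. I §3.1] -/
def partSeq (step : PowerSeries S → (ℕ → PowerSeries S) × PowerSeries S) (V : PowerSeries S) (n : ℕ) : ℕ → PowerSeries S :=
  Nat.rec (motive := fun _ => ℕ → PowerSeries S) (fun _ => 0)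
    (fun k P j => P j + PowerSeries.C (p ^ k) * (step (remSeq step V k)).1 j) n

/-- `C_{n+1} = C_n + p^n · (step V_n).1` (unfolding). [cite: deShalit1987, Ch. I §3.1] -/
theorem partSeq_succ (step : PowerSeries S → (ℕ → PowerSeries S) × PowerSeries S) (V : PowerSeries S) (n : ℕ) :
    partSeq p step V (n + 1) = partSeq p step V n + fun j => PowerSeries.C (p ^ n) * (step (remSeq step V n)).1 j := rfl


variable {D : PowerSeries S →ₗ[S] PowerSeries S}
  (hD : ∀ N (r : PowerSeries S), r ∈ adicFiltGen p N → D r ∈ adicFiltGen p (N + 1))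
  {d : ℕ} (hT : ∀ k : ℕ, D (PowerSeries.X ^ k) - PowerSeries.X ^ (k + d) ∈ degFilt p (k + d + 1))

variable [IsAdicComplete (Ideal.span {p}) S]

/-! ### Existence: every `V` is `Σ_{j<d} c_j·Y^j` -/


include hT in
/-- One step of the `p`-adic refinement, packaged: a pair `(c, W)` with `V = basisMap c + p · W`. [cite: deShalit1987, Ch. I §3.1] -/
theorem exists_liftPair (hd : 0 < d) (V : PowerSeries S) :
    ∃ cW : (ℕ → PowerSeries S) × PowerSeries S, V = basisMap D hD d cW.1 + PowerSeries.C p * cW.2 := by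
  obtain ⟨c, W, h⟩ := exists_basisMap_add_C_mul hD hT hd V
  exact ⟨(c, W), h⟩

/-- ★ `V = basisMap C_n + p^n · V_n` for every `n`, for any step with `R = basisMap (step R).1 + p · (step R).2`.
[cite: deShalit1987, Ch. I §3.1] -/
theorem eq_basisMap_partSeq_add {step : PowerSeries S → (ℕ → PowerSeries S) × PowerSeries S}
    (hstep : ∀ R, R = basisMap D hD d (step R).1 + PowerSeries.C p * (step R).2) (V : PowerSeries S) (n : ℕ) :
    V = basisMap D hD d (partSeq p step V n) + PowerSeries.C (p ^ n) * remSeq step V n := by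
  induction n with
  | zero =>
    change V = basisMap D hD d (fun _ => 0) + PowerSeries.C (p ^ 0) * V
    rw [basisMap_zero, pow_zero, map_one, one_mul, zero_add]
  | succ n ih =>
    rw [partSeq_succ, remSeq_succ, basisMap_add, basisMap_C_mul, pow_succ, map_mul]
    conv_lhs => rw [ih, hstep (remSeq step V n)]
    ring

include hT in
/-- ★★ **Existence**: every `V ∈ S⟦Y⟧` is `Σ_{j<d} c_j·Y^j` (`p`-adic successive approximation; `S` `(p)`-adically complete).
[cite: deShalit1987, Ch. I §3.1] -/
theorem exists_basisMap_eq (hd : 0 < d) (V : PowerSeries S) : ∃ c : ℕ → PowerSeries S, basisMap D hD d c = V := by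
  set step : PowerSeries S → (ℕ → PowerSeries S) × PowerSeries S := fun R => Classical.choose (exists_liftPair hD hT hd R) with hstep_def
  have hstep : ∀ R, R = basisMap D hD d (step R).1 + PowerSeries.C p * (step R).2 := fun R =>
    Classical.choose_spec (exists_liftPair hD hT hd R)
  -- the partial sums are `p`-adically Cauchy, coefficientwise in `j`
  have hcauchy : ∀ j N, partSeq p step V (N + 1 + 1) j - partSeq p step V (N + 1) j ∈ adicFiltGen p (N + 1) := by
    intro j N
    rw [partSeq_succ, Pi.add_apply, add_sub_cancel_left]
    have h := mul_mem_adicFiltGen (C_mem_adicFiltGen (p := p) (N := N + 1) (Ideal.mem_span_singleton_self _))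
      (mem_adicFiltGen_zero (p := p) ((step (remSeq step V (N + 1))).1 j))
    rwa [Nat.add_zero] at h
  have hlim : ∀ j, ∃ L : PowerSeries S, ∀ N, L - partSeq p step V (N + 1) j ∈ adicFiltGen p (N + 1) := fun j =>
    exists_forall_sub_mem_adicFiltGen (p := p) (fun N => partSeq p step V (N + 1) j) (hcauchy j)
  choose L hL using hlim
  refine ⟨L, sub_eq_zero.mp (eq_zero_of_forall_mem_adicFiltGen (p := p) fun N => ?_)⟩
  rcases Nat.eq_zero_or_pos N with rfl | hN
  · exact mem_adicFiltGen_zero _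
  obtain ⟨N, rfl⟩ := Nat.exists_eq_add_of_le' hN
  have e : basisMap D hD d L - V = basisMap D hD d (L - partSeq p step V (N + 1)) -
      PowerSeries.C (p ^ (N + 1)) * remSeq step V (N + 1) := by
    rw [basisMap_sub]
    conv_lhs => rw [eq_basisMap_partSeq_add hD hstep V (N + 1)]
    ring
  rw [e]
  refine sub_mem (basisMap_mem_adicFiltGen hD fun j _ => hL j N) ?_
  have h := mul_mem_adicFiltGen (C_mem_adicFiltGen (p := p) (N := N + 1) (Ideal.mem_span_singleton_self _))
    (mem_adicFiltGen_zero (p := p) (remSeq step V (N + 1)))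
  rwa [Nat.add_zero] at h

/-! ### Uniqueness -/

include hT in
/-- ★ **Leading coefficients**: if `Σ_{j<d} c_j·Y^j = 0` then every `[T^k]c_j` (`j < d`) lies in `(p)` (induction on `n = j + kd`:
the coefficient of `Y^n` of `Σ s_{n'} triBasis n'` is `≡ s_n` modulo `p` and the `s_{n'}`, `n' < n`). [cite: deShalit1987, Ch. I §3.1] -/
theorem coeff_mem_of_basisMap_eq_zero (hd : 0 < d) {c : ℕ → PowerSeries S} (hc : basisMap D hD d c = 0) :
    ∀ n, PowerSeries.coeff (n / d) (c (n % d)) ∈ Ideal.span {p} := by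
  intro n
  induction n using Nat.strong_induction_on with
  | _ n ih =>
    have hK := basisMap_sub_sum_mem hD hd c (n + 1)
    rw [hc, zero_sub, neg_mem_iff] at hK
    have hn : n ∈ range (d * (n + 1)) := mem_range.mpr (by nlinarith)
    have key := hK n (Nat.lt_succ_self n)
    rw [map_sum, ← add_sum_erase _ _ hn, PowerSeries.coeff_C_mul] at key
    have hrest : ∑ n' ∈ (range (d * (n + 1))).erase n,
        PowerSeries.coeff n (PowerSeries.C (PowerSeries.coeff (n' / d) (c (n' % d))) * triBasis D d n') ∈ Ideal.span {p} := by
      refine Ideal.sum_mem _ fun n' hn' => ?_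
      rw [PowerSeries.coeff_C_mul]
      rcases lt_or_gt_of_ne (ne_of_mem_erase hn') with h | h
      · exact Ideal.mul_mem_right _ _ (ih n' h)
      · exact Ideal.mul_mem_left _ _ (coeff_triBasis_mem_of_lt hD hT h)
    have h1 : PowerSeries.coeff (n / d) (c (n % d)) * PowerSeries.coeff n (triBasis D d n) ∈ Ideal.span {p} := by
      have h := sub_mem key hrest
      rwa [add_sub_cancel_right] at h
    have e : PowerSeries.coeff (n / d) (c (n % d)) = PowerSeries.coeff (n / d) (c (n % d)) * PowerSeries.coeff n (triBasis D d n) -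
        PowerSeries.coeff (n / d) (c (n % d)) * (PowerSeries.coeff n (triBasis D d n) - 1) := by ring
    rw [e]
    exact sub_mem h1 (Ideal.mul_mem_left _ _ (coeff_triBasis_self_sub_one_mem hD hT n))

include hT in
/-- The same, indexed by `j < d` and `k`. [cite: deShalit1987, Ch. I §3.1] -/
theorem coeff_mem_of_basisMap_eq_zero' (hd : 0 < d) {c : ℕ → PowerSeries S} (hc : basisMap D hD d c = 0) {j : ℕ} (hj : j < d)
    (k : ℕ) : PowerSeries.coeff k (c j) ∈ Ideal.span {p} := by
  have h := coeff_mem_of_basisMap_eq_zero hD hT hd hc (j + k * d)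
  rwa [Nat.add_mul_div_right j k hd, Nat.div_eq_of_lt hj, Nat.zero_add, Nat.add_mul_mod_self_right, Nat.mod_eq_of_lt hj] at h

include hT in
/-- ★ **Division by `p`**: if `Σ c_j·Y^j = 0` then `[T^k]c_j ∈ (p^N)` for all `N` (`p` a non-zero-divisor of `S`).
[cite: deShalit1987, Ch. I §3.1] -/
theorem coeff_mem_pow_of_basisMap_eq_zero (hd : 0 < d) (hp : ∀ x : S, p * x = 0 → x = 0) :
    ∀ (N : ℕ) {c : ℕ → PowerSeries S}, basisMap D hD d c = 0 → ∀ {j : ℕ}, j < d → ∀ k, PowerSeries.coeff k (c j) ∈ Ideal.span {p ^ N} := by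
  intro N
  induction N with
  | zero => intro c _ j _ k; rw [pow_zero, Ideal.span_singleton_one]; exact Submodule.mem_top
  | succ N ih =>
    intro c hc j hj k
    have h1 : ∀ j', j' < d → ∀ k', ∃ a : S, PowerSeries.coeff k' (c j') = p * a := fun j' hj' k' => by
      obtain ⟨a, ha⟩ := Ideal.mem_span_singleton'.mp (coeff_mem_of_basisMap_eq_zero' hD hT hd hc hj' k')
      exact ⟨a, by rw [← ha, mul_comm]⟩
    choose! a ha using h1
    have hcc' : ∀ j', j' < d → c j' = PowerSeries.C p * PowerSeries.mk (a j') := fun j' hj' => by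
      ext k'; rw [PowerSeries.coeff_C_mul, PowerSeries.coeff_mk, ha j' hj' k']
    have hΦ : basisMap D hD d c = PowerSeries.C p * basisMap D hD d (fun j' => PowerSeries.mk (a j')) := by
      rw [← basisMap_C_mul, basisMap_def, basisMap_def]
      exact sum_congr rfl fun j' hj' => by rw [hcc' j' (mem_range.mp hj')]
    have hc' : basisMap D hD d (fun j' => PowerSeries.mk (a j')) = 0 := by
      rw [hc] at hΦ
      ext k'
      have h := congrArg (PowerSeries.coeff k') hΦ
      rw [map_zero, PowerSeries.coeff_C_mul] at h
      rw [map_zero]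
      exact hp _ h.symm
    have h2 := ih hc' hj k
    rw [PowerSeries.coeff_mk] at h2
    obtain ⟨b, hb⟩ := Ideal.mem_span_singleton.mp h2
    rw [ha j hj k, hb, ← mul_assoc, ← pow_succ']
    exact Ideal.mem_span_singleton.mpr (dvd_mul_right _ _)

include hT in
/-- ★★ **Uniqueness**: `Σ_{j<d} c_j·Y^j = 0 ⟹ c_j = 0` for `j < d` (`p` a non-zero-divisor, `S` `(p)`-adically Hausdorff).
[cite: deShalit1987, Ch. I §3.1] -/
theorem eq_zero_of_basisMap_eq_zero (hd : 0 < d) (hp : ∀ x : S, p * x = 0 → x = 0) {c : ℕ → PowerSeries S}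
    (hc : basisMap D hD d c = 0) {j : ℕ} (hj : j < d) : c j = 0 := by
  ext k
  rw [map_zero]
  refine IsHausdorff.haus' (I := Ideal.span {p}) _ fun N => ?_
  rw [SModEq.sub_mem, sub_zero, smul_eq_mul, Ideal.mul_top, Ideal.span_singleton_pow]
  exact coeff_mem_pow_of_basisMap_eq_zero hD hT hd hp N hc hj k

include hT in
/-- ★★ **Injectivity**: `Σ c_j·Y^j = Σ c′_j·Y^j ⟹ c_j = c′_j` for `j < d`. [cite: deShalit1987, Ch. I §3.1] -/
theorem eq_of_basisMap_eq (hd : 0 < d) (hp : ∀ x : S, p * x = 0 → x = 0) {c c' : ℕ → PowerSeries S}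
    (h : basisMap D hD d c = basisMap D hD d c') {j : ℕ} (hj : j < d) : c j = c' j := by
  have h0 : basisMap D hD d (c - c') = 0 := by rw [basisMap_sub, h, sub_self]
  exact sub_eq_zero.mp (eq_zero_of_basisMap_eq_zero hD hT hd hp h0 hj)

/-! ### Freeness -/

include hT in
/-- ★★★ **`S⟦Y⟧` is free of rank `d` over `S⟦T⟧` with basis `1, Y, …, Y^{d−1}`** for the action `c·r = Σ c_k D^k r`: every `V` is
uniquely `Σ_{j<d} c_j(T)·Y^j` (`S` `(p)`-adically complete, `p` a non-zero-divisor, `D(I_N) ⊆ I_{N+1}`,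
`D(Y^k) ≡ Y^{k+d} (mod p, Y^{k+d+1})`). [cite: deShalit1987, Ch. I §3.1, §3.7] -/
theorem existsUnique_basisMap (hd : 0 < d) (hp : ∀ x : S, p * x = 0 → x = 0) (V : PowerSeries S) :
    ∃ c : ℕ → PowerSeries S, basisMap D hD d c = V ∧ ∀ c' : ℕ → PowerSeries S, basisMap D hD d c' = V → ∀ j, j < d → c' j = c j := by
  obtain ⟨c, hc⟩ := exists_basisMap_eq hD hT hd V
  exact ⟨c, hc, fun c' hc' j hj => eq_of_basisMap_eq hD hT hd hp (hc'.trans hc.symm) hj⟩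

omit hT in
/-- ★★★ **Rank two** (`d = 2`): if `D(Y^k) ≡ Y^{k+2} (mod p, Y^{k+3})` for all `k`, every `V ∈ S⟦Y⟧` is UNIQUELY `a(T)·1 + b(T)·Y` —
`S⟦Y⟧ = S⟦T⟧·1 ⊕ S⟦T⟧·Y` is free of rank two over `S⟦T⟧` (the shape of the Coleman coordinate module at `q = 2` under
`T = σ_γ − 1`, `γ` a topological generator of `1 + 4ℤ₂`: `𝒪⟦Y⟧ ≅ Λ(ℤ₂^×) = 𝒪[Δ]⟦T⟧`, `|Δ| = 2`). [cite: deShalit1987, Ch. I §3.1, §3.7] -/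
theorem existsUnique_tAct_one_add_tAct_X (hp : ∀ x : S, p * x = 0 → x = 0)
    (hT : ∀ k : ℕ, D (PowerSeries.X ^ k) - PowerSeries.X ^ (k + 2) ∈ degFilt p (k + 2 + 1)) (V : PowerSeries S) :
    ∃! ab : PowerSeries S × PowerSeries S, tAct D hD ab.1 1 + tAct D hD ab.2 PowerSeries.X = V := by
  have e : ∀ c : ℕ → PowerSeries S, basisMap D hD 2 c = tAct D hD (c 0) 1 + tAct D hD (c 1) PowerSeries.X := fun c => by
    rw [basisMap_def, sum_range_succ, sum_range_one, pow_zero, pow_one]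
  obtain ⟨c, hc, huniq⟩ := existsUnique_basisMap hD hT (by norm_num) hp V
  refine ⟨(c 0, c 1), ?_, fun ab hab => ?_⟩
  · change tAct D hD (c 0) 1 + tAct D hD (c 1) PowerSeries.X = V
    rw [← e, hc]
  · have h := huniq (fun j => if j = 0 then ab.1 else ab.2) (by rw [e]; simpa using hab)
    have h0 : ab.1 = c 0 := by simpa using h 0 (by norm_num)
    have h1 : ab.2 = c 1 := by simpa using h 1 (by norm_num)
    exact Prod.ext h0 h1

end TopNilpotentBasisFree

end LubinTate

end Literature.NumberTheory.GaloisRepresentations
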